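import Summits.BirchSwinnertonDyer.Rank1Residual.F1Sign2.GenusClassGoverningFieldAtTwo
import HarnessLib

/-!
# DESC-32 kernel — REF1 §196's sorry-free BC7 certificates for `F1Sign2/GenusClassGoverningFieldAtTwo.lean` (typer -ty g19; proofs only, no `def`)

THEOREMS ONLY, sub-namespace `…F1Sign2.GenusClassGoverningFieldKernel` (so REF1's `bc7_*` names do not crowd the cell namespace; the g18 `GenusClassSwitchingAtTwoKernel`
precedent).  Source `HOME/REF1-data/b196/lean/Probe196a.lean` **a338928907dbf390** l.162–201, VERBATIM: BC7-3 `bc7_nat_to_rat_currency` — THE DICTIONARY behind REF1's mandatory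
re-typing R196a, in which the statement file's DESC-32-G/B are filed: for `n : ℕ`, `n ≠ 0`, `16 ∣ n ⟺ 4 ≤ v₂ (n : ℚ)`, `n` odd `⟺ v₂ = 0`, and `0 ≤ v₂` for free — so the
`ℚ`/`padicValRat 2` form keeps the two bits and is a pure WEAKENING of -desc g23's `∃ n : ℕ` form (which asserted all-prime integrality of `#Ш_an`, REF1 FINDINGS 32 (i));
BC7-4 `bc7_doorResidueDegree_zero` (junk guard: `DoorResidueDegree M q 0` is false once a prime of `𝓞 M` contains `q`, so DESC-32-B's free degrees cannot trivialise the
bits via `f = 0`); BC7-5 `bc7_genusClass_congruence` (`(−p) % 8 = 1` over `ℤ` pins `p ≡ 7 (mod 8)`: 7, 23, 31 pass, 3 fails); BC7-6 `bc7_genusClass_odd_prime`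
(`InGenusClassAtTwo W p → p.Prime ∧ p ≠ 2`).  NOT ported: BC7-1/2 `bc7_32G_forces_integrality` / `bc7_32B_forces_integrality` — they are theorems about the v1 (`∃ n : ℕ`)
texts of G/B, which are not in the tree (they were the REASON for R196a).  -desc's glue `frobenian_of_governing` is in the statement file (verbatim).  REF1 §196 (A1): farm
rc 0, std axioms.  Nothing here bears on BSD; 23715 not closed.
-/

open scoped Classical

open WeierstrassCurve Literature.NumberTheory.EllipticCurves NumberField

namespace Summit.BirchSwinnertonDyer.Rank1Residual.F1Sign2.GenusClassGoverningFieldKernel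

/-! ## REF1 §196 BC7 lemmas for Sketch32 (sorry-free; BC7-3 … BC7-6 VERBATIM) -/

/-- BC7-3 (the DICTIONARY for the recommended re-typing R196a): for a natural number `n ≠ 0` the two bits of DESC-32-G/B are 2-adic valuation
conditions on `(n : ℚ)` — `16 ∣ n ⟺ 4 ≤ v₂`, `n odd ⟺ v₂ = 0` — and `0 ≤ v₂` comes for free; so the `ℚ`/`padicValRat` form is a pure WEAKENING
of the typed form (drop integrality at the odd primes and at 2 below the bit, keep the bits). -/
theorem bc7_nat_to_rat_currency (n : ℕ) (hn : n ≠ 0) :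
    (16 ∣ n ↔ 4 ≤ padicValRat 2 (n : ℚ)) ∧ (Odd n ↔ padicValRat 2 (n : ℚ) = 0) ∧ 0 ≤ padicValRat 2 (n : ℚ) := by
  have h1 : padicValRat 2 (n : ℚ) = padicValNat 2 n := padicValRat.of_nat
  refine ⟨?_, ?_, ?_⟩
  · rw [h1, show (16 : ℕ) = 2 ^ 4 by norm_num, padicValNat_dvd_iff_le hn]
    norm_cast
  · rw [h1, ← Nat.not_even_iff_odd, even_iff_two_dvd]
    constructor
    · intro h
      exact_mod_cast padicValNat.eq_zero_of_not_dvd h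
    · intro h
      have h0 : padicValNat 2 n = 0 := by exact_mod_cast h
      rcases padicValNat.eq_zero_iff.mp h0 with h2 | h2 | h2
      · norm_num at h2
      · exact absurd h2 hn
      · exact h2
  · rw [h1]
    exact_mod_cast Nat.zero_le _

/-- BC7-4 (junk guard of the residue-degree carrier): `DoorResidueDegree M q 0` is FALSE as soon as one prime of `𝓞 M` contains `q` (a residue ring of
cardinality `q⁰ = 1` would be the quotient by `⊤`) — so the unconstrained degrees `f₃ f₁ : ℕ` of DESC-32-B cannot be used to trivialise the bits via `f = 0`. -/
theorem bc7_doorResidueDegree_zero {M : Type} [Field M] [NumberField M] (q : ℕ)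
    (Q : Ideal (𝓞 M)) (hQ : Q.IsPrime) (hq : ((q : ℤ) : 𝓞 M) ∈ Q) : ¬ DoorResidueDegree M q 0 := by
  intro h
  have h1 := h Q hQ hq
  rw [pow_zero] at h1
  have hs : Subsingleton (𝓞 M ⧸ Q) := (Nat.card_eq_one_iff_unique.mp h1).1
  exact hQ.ne_top (Ideal.Quotient.subsingleton_iff.mp hs)

/-- BC7-5: the genus-class carrier excludes `p = 2` and pins `p ≡ 7 (mod 8)` (`(−p) % 8 = 1` over `ℤ`), e.g. `p = 7, 23, 31` pass the congruence and `p = 3` does not. -/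
theorem bc7_genusClass_congruence : (-(7 : ℤ)) % 8 = 1 ∧ (-(23 : ℤ)) % 8 = 1 ∧ (-(31 : ℤ)) % 8 = 1 ∧ (-(3 : ℤ)) % 8 ≠ 1 := by
  decide

/-- BC7-6: `InGenusClassAtTwo W p → p ≠ 2 ∧ p.Prime` (projection; the statement never meets the junk `frobeniusTrace 2` / reduction at `2`). -/
theorem bc7_genusClass_odd_prime (W : WeierstrassCurve ℚ) [W.IsGloballyMinimal] (p : ℕ) (h : InGenusClassAtTwo W p) :
    p.Prime ∧ p ≠ 2 :=
  ⟨h.1, h.2.1⟩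

end Summit.BirchSwinnertonDyer.Rank1Residual.F1Sign2.GenusClassGoverningFieldKernel
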